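import Literature.Analysis.Complex.StripPeriodicExtension
import HarnessLib

/-!
# Rigidity of holomorphic functions on a strip with non-negative boundary values on both lines

**Theorem (`strip_rigidity_of_nonneg_boundary_values`).** Let `u` be holomorphic on the open strip
`S = {0 < im w < 1}`, continuous on the closed strip, of exponential type `a < 2π` in `re w`
(`‖u w‖ ≤ C e^{a |re w|}` on the closed strip), and suppose `u(x) ≥ 0` and `u(x + i) ≥ 0` are real for
every real `x`. Then `u` is a non-negative constant.

Proof (`Literature/Analysis/Complex/StripPeriodicExtension.lean` supplies the pieces): Schwarz reflection
across the real axis and periodisation give an entire `2i`-periodic function `E` extending `u`, with the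
same type bound; such a function is `c₁ e^{-πw} + c₂ + c₃ e^{πw}` (`exists_three_modes_of_periodic`: in
`q = e^{πw}` the bound leaves the Laurent modes `q⁻¹, 1, q`); on the bottom line `q = e^{πx} > 0` and on
the line `im w = -1` (the reflection of the top line) `q = -e^{πx} < 0`, and non-negativity of
`c₁ q⁻¹ + c₂ + c₃ q` on both half-axes forces `c₁ = c₃ = 0 ≤ c₂` (`laurent_modes_killed`, the
elementary endgame, due to the line lead of crux `ParafermionToSLESixFamilies`, skeleton
`Summits/CriticalPhenomena/CardyFormulaZ2/Cruxes/ParafermionToSLESixFamilies/Lines/iic_trace_flux_pairing.lean`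
§4, copied verbatim). The example `u = 1 + e^{2πw}` (positive on both lines, since
`e^{2π(x+i)} = e^{2πx}`; type exactly `2π`) shows that `a < 2π` is sharp, and `u = e^{πw}` (positive on the
bottom line, negative on the top line) shows that positivity on BOTH lines is needed once `a ≥ π`; for
`a < π` realness alone suffices (the tree's `apply_eq_apply_of_periodic_of_norm_le_exp`, or
`eq_const_of_im_eq_zero_on_boundary` for bounded `u`).

This is the continuous-boundary-value form of the "strip rigidity" lemma (stub `stub_stripRigidity`,
`StripRigidityWeak`) of the line `iic-trace-flux-pairing` of crux `ParafermionToSLESixFamilies`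
(Cardy's formula on `ℤ²`): there `u = (f/(Φ′)^{1/3}) ∘ Φ⁻¹` for a subsequential scaling limit `f` of the
parafermionic observable transported to the strip, and the conclusion `u ≡ c ≥ 0` identifies
`f = c (Φ′)^{1/3}`. The weak-boundary-value form is reduced to this one by mollification in `re w`.

References: standard (Schwarz reflection: Conway, *Functions of One Complex Variable I*, IX.1.1;
periodic entire functions of exponential type: Boas, *Entire Functions*, §6.10). All statements folklore.
-/

noncomputable section

namespace Literature.Analysis.Complex

open _root_.Complex Set Filter Metric
open scoped ComplexConjugate Topology Real

/-! ### The mode-killing algebra (positivity on both lines is load-bearing)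

The three lemmas below are due to the line lead of crux `ParafermionToSLESixFamilies`
(skeleton `Cruxes/ParafermionToSLESixFamilies/Lines/iic_trace_flux_pairing.lean`, §4), copied verbatim. -/

/-- Odd-part bound: if `c₋₁ ζ⁻¹ + c₀ + c₁ ζ ≥ 0` for `ζ > 0` and for `ζ < 0`, then `|c₋₁/t + c₁ t| ≤ c₀` for
`t > 0` (evaluate at `±t` and subtract). [folklore] -/
theorem laurent_odd_part_le (cm c₀ c₁ : ℝ)
    (hpos : ∀ ζ : ℝ, 0 < ζ → 0 ≤ cm / ζ + c₀ + c₁ * ζ)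
    (hneg : ∀ ζ : ℝ, ζ < 0 → 0 ≤ cm / ζ + c₀ + c₁ * ζ) :
    ∀ t : ℝ, 0 < t → |cm / t + c₁ * t| ≤ c₀ := by
  intro t ht
  have h1 := hpos t ht
  have h2 := hneg (-t) (by linarith)
  have e : cm / (-t) + c₀ + c₁ * (-t) = -(cm / t + c₁ * t) + c₀ := by ring
  rw [e] at h2
  rw [abs_le]
  constructor <;> linarith

/-- The top Laurent mode dies: under the two positivity conditions, `c₁ = 0` and `0 ≤ c₀`
(`2·g(2t) − g(t) = 3c₁t` for the odd part `g`, so `|c₁| t ≤ c₀` for every `t > 0`). [folklore] -/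
theorem laurent_top_mode_killed (cm c₀ c₁ : ℝ)
    (hpos : ∀ ζ : ℝ, 0 < ζ → 0 ≤ cm / ζ + c₀ + c₁ * ζ)
    (hneg : ∀ ζ : ℝ, ζ < 0 → 0 ≤ cm / ζ + c₀ + c₁ * ζ) :
    c₁ = 0 ∧ 0 ≤ c₀ := by
  have hodd := laurent_odd_part_le cm c₀ c₁ hpos hneg
  have hc₀ : 0 ≤ c₀ := le_trans (abs_nonneg _) (hodd 1 one_pos)
  have hbound : ∀ t : ℝ, 0 < t → |c₁| * t ≤ c₀ := by
    intro t ht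
    have h1 := hodd t ht
    have h2 := hodd (2 * t) (by linarith)
    have ht0 : t ≠ 0 := ht.ne'
    have e : 3 * (c₁ * t) = 2 * (cm / (2 * t) + c₁ * (2 * t)) + -(cm / t + c₁ * t) := by
      field_simp
      ring
    have h3 : |3 * (c₁ * t)| ≤ 2 * |cm / (2 * t) + c₁ * (2 * t)| + |cm / t + c₁ * t| := by
      rw [e]
      calc |2 * (cm / (2 * t) + c₁ * (2 * t)) + -(cm / t + c₁ * t)|
          ≤ |2 * (cm / (2 * t) + c₁ * (2 * t))| + |-(cm / t + c₁ * t)| := abs_add_le _ _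
        _ = 2 * |cm / (2 * t) + c₁ * (2 * t)| + |cm / t + c₁ * t| := by
          rw [abs_neg, abs_mul, abs_of_pos (by norm_num : (0:ℝ) < 2)]
    rw [abs_mul, abs_of_pos (by norm_num : (0:ℝ) < 3), abs_mul, abs_of_pos ht] at h3
    linarith
  refine ⟨?_, hc₀⟩
  by_contra h
  have hc : 0 < |c₁| := abs_pos.2 h
  have hne : |c₁| ≠ 0 := hc.ne'
  have hb := hbound ((c₀ + 1) / |c₁|) (by positivity)
  have e : |c₁| * ((c₀ + 1) / |c₁|) = c₀ + 1 := by
    field_simp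
  linarith

/-- The three surviving Laurent modes `c₋₁ ζ⁻¹ + c₀ + c₁ ζ` (real coefficients) are non-negative on `ζ > 0`
AND on `ζ < 0` only if `c₁ = c₋₁ = 0 ≤ c₀`; the bottom mode follows from the top one by `ζ ↦ ζ⁻¹`.
[folklore] -/
theorem laurent_modes_killed (cm c₀ c₁ : ℝ)
    (hpos : ∀ ζ : ℝ, 0 < ζ → 0 ≤ cm / ζ + c₀ + c₁ * ζ)
    (hneg : ∀ ζ : ℝ, ζ < 0 → 0 ≤ cm / ζ + c₀ + c₁ * ζ) :
    c₁ = 0 ∧ cm = 0 ∧ 0 ≤ c₀ := by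
  obtain ⟨hc₁, hc₀⟩ := laurent_top_mode_killed cm c₀ c₁ hpos hneg
  have e : ∀ ξ : ℝ, ξ ≠ 0 → cm / ξ⁻¹ + c₀ + c₁ * ξ⁻¹ = c₁ / ξ + c₀ + cm * ξ := by
    intro ξ hξ
    rw [div_inv_eq_mul, ← div_eq_mul_inv]
    ring
  have hpos' : ∀ ξ : ℝ, 0 < ξ → 0 ≤ c₁ / ξ + c₀ + cm * ξ := by
    intro ξ hξ
    have := hpos ξ⁻¹ (inv_pos.2 hξ)
    rwa [e ξ hξ.ne'] at this
  have hneg' : ∀ ξ : ℝ, ξ < 0 → 0 ≤ c₁ / ξ + c₀ + cm * ξ := by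
    intro ξ hξ
    have := hneg ξ⁻¹ (inv_lt_zero.2 hξ)
    rwa [e ξ hξ.ne] at this
  obtain ⟨hcm, -⟩ := laurent_top_mode_killed c₁ c₀ cm hpos' hneg'
  exact ⟨hc₁, hcm, hc₀⟩

/-- Complex form of the mode-killing: if `c₁ ζ⁻¹ + c₂ + c₃ ζ` and `-c₁ ζ⁻¹ + c₂ - c₃ ζ` are non-negative reals
for every `ζ > 0`, then `c₁ = c₃ = 0` and `c₂` is a non-negative real. [folklore] -/
theorem modes_killed_complex (c₁ c₂ c₃ : ℂ)
    (hpos : ∀ ζ : ℝ, 0 < ζ → ∃ r : ℝ, 0 ≤ r ∧ c₁ * ((ζ⁻¹ : ℝ) : ℂ) + c₂ + c₃ * (ζ : ℂ) = r)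
    (hneg : ∀ ζ : ℝ, 0 < ζ → ∃ r : ℝ, 0 ≤ r ∧ -(c₁ * ((ζ⁻¹ : ℝ) : ℂ)) + c₂ - c₃ * (ζ : ℂ) = r) :
    c₁ = 0 ∧ c₃ = 0 ∧ c₂ = (c₂.re : ℂ) ∧ 0 ≤ c₂.re := by
  -- real and imaginary parts
  have hre : ∀ ζ : ℝ, 0 < ζ → 0 ≤ c₁.re / ζ + c₂.re + c₃.re * ζ ∧ c₁.im / ζ + c₂.im + c₃.im * ζ = 0 := by
    intro ζ hζ
    obtain ⟨r, hr, h⟩ := hpos ζ hζ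
    have h1 := congrArg Complex.re h
    have h2 := congrArg Complex.im h
    simp only [add_re, mul_re, ofReal_re, ofReal_im, mul_zero, sub_zero, add_im, mul_im,
      zero_add] at h1 h2
    refine ⟨?_, ?_⟩
    · rw [div_eq_mul_inv]; linarith
    · rw [div_eq_mul_inv]; linarith
  have hre' : ∀ ζ : ℝ, 0 < ζ → 0 ≤ -(c₁.re / ζ) + c₂.re - c₃.re * ζ ∧
      -(c₁.im / ζ) + c₂.im - c₃.im * ζ = 0 := by
    intro ζ hζ
    obtain ⟨r, hr, h⟩ := hneg ζ hζ
    have h1 := congrArg Complex.re h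
    have h2 := congrArg Complex.im h
    simp only [add_re, neg_re, mul_re, ofReal_re, ofReal_im, mul_zero, sub_zero, sub_re, add_im,
      neg_im, mul_im, zero_add, sub_im] at h1 h2
    refine ⟨?_, ?_⟩
    · rw [div_eq_mul_inv]; linarith
    · rw [div_eq_mul_inv]; linarith
  -- imaginary parts vanish
  have i1 := (hre 1 one_pos).2
  have i1' := (hre' 1 one_pos).2
  have i2 := (hre 2 two_pos).2
  have him2 : c₂.im = 0 := by simp at i1 i1'; linarith
  have him3 : c₃.im = 0 := by simp at i1 i2; linarith
  have him1 : c₁.im = 0 := by simp at i1; linarith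
  -- real parts: the lead's mode-killing algebra
  have hP : ∀ ζ : ℝ, 0 < ζ → 0 ≤ c₁.re / ζ + c₂.re + c₃.re * ζ := fun ζ hζ => (hre ζ hζ).1
  have hN : ∀ ζ : ℝ, ζ < 0 → 0 ≤ c₁.re / ζ + c₂.re + c₃.re * ζ := by
    intro ζ hζ
    have := (hre' (-ζ) (by linarith)).1
    have e : c₁.re / ζ + c₂.re + c₃.re * ζ = -(c₁.re / (-ζ)) + c₂.re - c₃.re * (-ζ) := by
      rw [div_neg]; ring
    rw [e]; exact this
  obtain ⟨h3, h1, h2⟩ := laurent_modes_killed c₁.re c₂.re c₃.re hP hN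
  refine ⟨Complex.ext (by simpa using h1) (by simpa using him1),
    Complex.ext (by simpa using h3) (by simpa using him3),
    Complex.ext (by simp) (by simpa using him2), h2⟩

/-- **Strip rigidity from non-negative boundary values (continuous form).** Let `u` be holomorphic on the
open strip `S = {0 < im w < 1}`, continuous on the closed strip, of exponential type `a < 2π` in `re w`
(`‖u w‖ ≤ C e^{a |re w|}`), with `u(x) ≥ 0` and `u(x + i) ≥ 0` real for every real `x`. Then `u` is a
non-negative constant. Proof: Schwarz reflection across both lines gives an entire `2i`-periodic function, i.e. a
holomorphic function of `q = e^{πw}` on `ℂˣ`; the type bound leaves the Laurent modes `q⁻¹, 1, q`, and positivity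
on `q > 0` (bottom line) and `q < 0` (top line) kills `q^{∓1}`. The example `c₀ + c₂ e^{2πw}` shows `a < 2π` is
sharp. [folklore] -/
theorem strip_rigidity_of_nonneg_boundary_values (u : ℂ → ℂ) (C a : ℝ) (ha : a < 2 * Real.pi)
    (hd : DifferentiableOn ℂ u {w : ℂ | 0 < w.im ∧ w.im < 1})
    (hc : ContinuousOn u {w : ℂ | 0 ≤ w.im ∧ w.im ≤ 1})
    (hb : ∀ w : ℂ, 0 ≤ w.im → w.im ≤ 1 → ‖u w‖ ≤ C * Real.exp (a * |w.re|))
    (h0 : ∀ x : ℝ, ∃ r : ℝ, 0 ≤ r ∧ u x = r)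
    (h1 : ∀ x : ℝ, ∃ r : ℝ, 0 ≤ r ∧ u (x + I) = r) :
    ∃ c : ℝ, 0 ≤ c ∧ ∀ w : ℂ, 0 ≤ w.im → w.im ≤ 1 → u w = c := by
  -- Step 1: reflect across the real axis
  have h0' : ∀ x : ℝ, (u x).im = 0 := by
    intro x; obtain ⟨r, -, hr⟩ := h0 x; rw [hr]; simp
  obtain ⟨U, hUu, hUconj, hUc, hUd⟩ := exists_reflection_real_axis u hd hc h0'
  -- Step 2: periodise (the values on `im = ±1` agree because `u (x + i)` is real)
  have hmatch : ∀ w : ℂ, w.im = 1 → U (w - 2 * I) = U w := by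
    intro w hw
    have e1 : w - 2 * I = conj w := Complex.ext (by simp) (by simp [hw]; norm_num)
    have e2 : w = ((w.re : ℂ) + I) := Complex.ext (by simp) (by simp [hw])
    obtain ⟨r, -, hr⟩ := h1 w.re
    rw [e1, hUconj, hUu w (by rw [hw]; norm_num), e2, hr, conj_ofReal]
  obtain ⟨E, hEd, hEper, hEU⟩ := exists_periodic_extension U hUc hUd hmatch
  -- Step 3: the bound transfers to `E`
  have hUb : ∀ w : ℂ, -1 ≤ w.im → w.im ≤ 1 → ‖U w‖ ≤ C * Real.exp (a * |w.re|) := by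
    intro w hw1 hw2
    rcases le_or_gt 0 w.im with h | h
    · rw [hUu w h]; exact hb w h hw2
    · have e : w = conj (conj w) := (Complex.conj_conj w).symm
      rw [e, hUconj, norm_conj, hUu _ (by simp; linarith)]
      have := hb (conj w) (by simp; linarith) (by simp; linarith)
      simpa using this
  have hEb : ∀ w : ℂ, ‖E w‖ ≤ C * Real.exp (a * |w.re|) := by
    intro w
    -- reduce `im w` to `[-1, 1)` using periodicity
    set m : ℤ := ⌊(w.im + 1) / 2⌋ with hm
    have hm' := Int.floor_eq_iff.mp hm.symm
    have key : ∀ n : ℕ, ∀ v : ℂ, E (v + n * (2 * I)) = E v := by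
      intro n; induction n with
      | zero => intro v; simp
      | succ n ih => intro v; rw [show v + ((n + 1 : ℕ) : ℂ) * (2 * I) = (v + n * (2 * I)) + 2 * I by
          push_cast; ring, hEper, ih]
    have key' : ∀ n : ℤ, ∀ v : ℂ, E (v + n * (2 * I)) = E v := by
      intro n v
      rcases Int.eq_nat_or_neg n with ⟨k, rfl | rfl⟩
      · exact_mod_cast key k v
      · have := key k (v + ((-(k:ℤ) : ℤ) : ℂ) * (2 * I))
        rw [← this]; congr 1; push_cast; ring
    set v : ℂ := w + ((-m : ℤ) : ℂ) * (2 * I) with hv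
    have hvim : v.im = w.im - 2 * m := by simp [hv]; ring
    have hvre : v.re = w.re := by simp [hv]
    rw [← key' (-m) w, hEU v (by rw [hvim]; linarith [hm'.1]) (by rw [hvim]; linarith [hm'.2]), ← hvre]
    exact hUb v (by rw [hvim]; linarith [hm'.1]) (by rw [hvim]; linarith [hm'.2])
  -- Step 4: three modes
  obtain ⟨c₁, c₂, c₃, hE⟩ := exists_three_modes_of_periodic E C a ha hEd hEper hEb
  -- Step 5: positivity on both lines kills `c₁, c₃`
  have hbot : ∀ x : ℝ, E x = u x := fun x => by rw [hEU x (by simp) (by simp), hUu x (by simp)]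
  have htop : ∀ x : ℝ, E (x - I) = conj (u (x + I)) := by
    intro x
    rw [hEU _ (by simp) (by simp), show (x : ℂ) - I = conj ((x : ℂ) + I) by
      apply Complex.ext <;> simp, hUconj, hUu _ (by simp)]
  have hexp : ∀ ζ : ℝ, 0 < ζ → exp (π * ((Real.log ζ / π : ℝ) : ℂ)) = (ζ : ℂ) ∧
      exp (-(π * ((Real.log ζ / π : ℝ) : ℂ))) = ((ζ⁻¹ : ℝ) : ℂ) := by
    intro ζ hζ
    have e : (π : ℂ) * ((Real.log ζ / π : ℝ) : ℂ) = (Real.log ζ : ℝ) := by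
      push_cast; field_simp
    rw [e, ← Complex.ofReal_neg, ← Complex.ofReal_exp, ← Complex.ofReal_exp, Real.exp_neg,
      Real.exp_log hζ]
    exact ⟨rfl, rfl⟩
  have hpos : ∀ ζ : ℝ, 0 < ζ → ∃ r : ℝ, 0 ≤ r ∧ c₁ * ((ζ⁻¹ : ℝ) : ℂ) + c₂ + c₃ * (ζ : ℂ) = r := by
    intro ζ hζ
    obtain ⟨r, hr, hur⟩ := h0 (Real.log ζ / π)
    refine ⟨r, hr, ?_⟩
    rw [← hur, ← hbot, hE, (hexp ζ hζ).1, (hexp ζ hζ).2]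
  have hneg : ∀ ζ : ℝ, 0 < ζ → ∃ r : ℝ, 0 ≤ r ∧ -(c₁ * ((ζ⁻¹ : ℝ) : ℂ)) + c₂ - c₃ * (ζ : ℂ) = r := by
    intro ζ hζ
    obtain ⟨r, hr, hur⟩ := h1 (Real.log ζ / π)
    refine ⟨r, hr, ?_⟩
    have := htop (Real.log ζ / π)
    rw [hur, conj_ofReal, hE] at this
    rw [← this]
    have e1 : exp (π * (((Real.log ζ / π : ℝ) : ℂ) - I)) = -(ζ : ℂ) := by
      rw [mul_sub, Complex.exp_sub, (hexp ζ hζ).1, show (π : ℂ) * I = π * I from rfl,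
        Complex.exp_pi_mul_I]; ring
    have e2 : exp (-(π * (((Real.log ζ / π : ℝ) : ℂ) - I))) = -((ζ⁻¹ : ℝ) : ℂ) := by
      rw [show -(↑π * (((Real.log ζ / π : ℝ) : ℂ) - I)) = -(π * ((Real.log ζ / π : ℝ) : ℂ)) + π * I by ring,
        Complex.exp_add, (hexp ζ hζ).2, Complex.exp_pi_mul_I]; ring
    rw [e1, e2]; ring
  obtain ⟨hc₁, hc₃, hc₂, hc₂pos⟩ := modes_killed_complex c₁ c₂ c₃ hpos hneg
  refine ⟨c₂.re, hc₂pos, fun w hw0 hw1 => ?_⟩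
  have hEc : ∀ v, E v = c₂ := by intro v; rw [hE v, hc₁, hc₃]; ring
  rcases hw1.lt_or_eq with hlt | heq
  · rw [← hUu w hw0, ← hEU w (by linarith) hlt, hEc, ← hc₂]
  · -- top line: `u w = conj (E (w - 2i))`-type bookkeeping
    have e2 : w = ((w.re : ℂ) + I) := Complex.ext (by simp) (by simp [heq])
    have := htop w.re
    rw [hEc, hc₂] at this
    have := congrArg conj this
    rw [Complex.conj_conj, conj_ofReal] at this
    rw [e2]; exact this.symm

end Literature.Analysis.Complex
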